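import Summits.QuantumAdvantage.QuantumAdvantage.Theses.ArithStatLadder
import Literature.Computability.Complexity.PlumbingBricks
import Literature.Computability.Complexity.StackBricksArith
import Literature.Computability.Complexity.ListFoldBricks

/-!
# Numeral expressions and one-bit tests on pairs `⟨w, y⟩`, compiled into `FP` bricks

Helper file for the crux `ArithStatLadder.IqThreeNotPPoly` (stmt-QuantumAdvantage-2422, `IQ3 ∉ P/poly`,
`IQ3 = bin {d : −d fundamental, 3 ∣ h(−d)}`), line `Sketch`, continuation lead c3 — part 1 of the
construction of the folklore membership `IQ3 ∈ PSPACE` that the crux's negative lemmas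
(`Negative.RefutationShape.PSPACE_not_subset_PPoly_of`, crux 2424's `Negative.RefutationCost`) so far
take as a hypothesis. Part 2 (`ArithStatLadderIqThreeNotPPolyClassNumberSharpP.lean`) shows that the
form class number `h(−⟦w⟧)` is a `#P` function by counting fixed-width witnesses `y = A T C` of a
polynomial-time verifier; this file is the verifier's toolkit, a small COMPILER of

* *numeral expressions* `φ : {0,1}* → {0,1}* → ℕ` — realised by `f ∈ FP` with `⟦f ⟨w, y⟩⟧ = φ w y`:
  the first component (`pairNat_fst`), constants, `+` (`addFn`), `×` (`prodFn`), `gcd` (`gcdFn`),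
  and the three `(|w|+1)`-bit blocks of `y` (`pairNat_blockA/T/C`, by `takeFn`/`dropFn` against the
  unary `1^{|w|+1}` of `polyFn`);
* *tests* `P : {0,1}* → {0,1}* → Prop` — realised by a one-bit `f ∈ FP` with
  `f ⟨w, y⟩ = [1] ↔ P w y`: `<`, `=`, `≤` (`ltFn`, `eqValFn`), `∧`, `∨`, `¬`, `→` (`andFn`, `orFn`,
  `notFn`).

All statements are existential (no definition is introduced); everything is assembled from the
tree's brick toolkit (`StackBricks*.lean`, `ListFoldBricks.lean`, `PlumbingBricks.lean`,
`BrickAlgebra.lean`, `StringEquality.fanoutFn`). Sorry-free; axioms ⊆ {propext, Classical.choice,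
Quot.sound}.

References: S. Arora, B. Barak, *Computational Complexity*, CUP 2009, §1.3 (polynomial time is
closed under composition and subroutine calls).
-/

noncomputable section

set_option linter.dupNamespace false

namespace Summit.QuantumAdvantage.QuantumAdvantage.Theorems.IqThreeNotPPoly

open _root_.Computability Polynomial
open Literature.Computability.Complexity Literature.Computability.Complexity.Brick

/-! ### A small compiler: numeral expressions and one-bit tests on pairs `⟨w, y⟩` into `FP` bricks

A *numeral expression* `φ` is realised by `f ∈ FP` with `⟦f ⟨w, y⟩⟧ = φ w y`; a *test* `P` by a
one-bit `f ∈ FP` with `f ⟨w, y⟩ = [1] ↔ P w y`. -/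

/-- The first component `⟦w⟧` is a numeral expression. -/
theorem pairNat_fst : ∃ f ∈ FP, ∀ w y : List Bool, bitsToNat (f (boolPair w y)) = bitsToNat w :=
  ⟨fstF, fstF_mem_FP, fun w y => by rw [fstF_boolPair]⟩

/-- Constants are numeral expressions. -/
theorem pairNat_const (n : ℕ) : ∃ f ∈ FP, ∀ w y : List Bool, bitsToNat (f (boolPair w y)) = n :=
  ⟨fun _ => encodeNat n, const_mem_FP _, fun _ _ => bitsToNat_encodeNat n⟩

/-- The value of any `FP` string function of the pair is a numeral expression. -/
theorem pairNat_of_mem_FP {g : List Bool → List Bool} (hg : g ∈ FP) :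
    ∃ f ∈ FP, ∀ w y : List Bool, bitsToNat (f (boolPair w y)) = bitsToNat (g (boolPair w y)) :=
  ⟨g, hg, fun _ _ => rfl⟩

/-- Sums of numeral expressions (`addFn`). -/
theorem pairNat_add {φ ψ : List Bool → List Bool → ℕ}
    (hφ : ∃ f ∈ FP, ∀ w y : List Bool, bitsToNat (f (boolPair w y)) = φ w y)
    (hψ : ∃ f ∈ FP, ∀ w y : List Bool, bitsToNat (f (boolPair w y)) = ψ w y) :
    ∃ f ∈ FP, ∀ w y : List Bool, bitsToNat (f (boolPair w y)) = φ w y + ψ w y := by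
  obtain ⟨p, hp, hpv⟩ := hφ
  obtain ⟨q, hq, hqv⟩ := hψ
  exact ⟨addFn ∘ fanoutFn p q, comp_mem_FP addFn_mem_FP (fanoutFn_mem_FP hp hq), fun w y => by
    rw [Function.comp_apply, fanoutFn_apply, addFn_boolPair, bitsToNat_encodeNat, hpv, hqv]⟩

/-- Products of numeral expressions (`prodFn`). -/
theorem pairNat_mul {φ ψ : List Bool → List Bool → ℕ}
    (hφ : ∃ f ∈ FP, ∀ w y : List Bool, bitsToNat (f (boolPair w y)) = φ w y)
    (hψ : ∃ f ∈ FP, ∀ w y : List Bool, bitsToNat (f (boolPair w y)) = ψ w y) :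
    ∃ f ∈ FP, ∀ w y : List Bool, bitsToNat (f (boolPair w y)) = φ w y * ψ w y := by
  obtain ⟨p, hp, hpv⟩ := hφ
  obtain ⟨q, hq, hqv⟩ := hψ
  exact ⟨prodFn ∘ fanoutFn p q, comp_mem_FP prodFn_mem_FP (fanoutFn_mem_FP hp hq), fun w y => by
    rw [Function.comp_apply, fanoutFn_apply, prodFn_boolPair, bitsToNat_encodeNat, hpv, hqv]⟩

/-- Greatest common divisors of numeral expressions (`gcdFn`). -/
theorem pairNat_gcd {φ ψ : List Bool → List Bool → ℕ}
    (hφ : ∃ f ∈ FP, ∀ w y : List Bool, bitsToNat (f (boolPair w y)) = φ w y)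
    (hψ : ∃ f ∈ FP, ∀ w y : List Bool, bitsToNat (f (boolPair w y)) = ψ w y) :
    ∃ f ∈ FP, ∀ w y : List Bool, bitsToNat (f (boolPair w y)) = Nat.gcd (φ w y) (ψ w y) := by
  obtain ⟨p, hp, hpv⟩ := hφ
  obtain ⟨q, hq, hqv⟩ := hψ
  exact ⟨gcdFn ∘ fanoutFn p q, comp_mem_FP gcdFn_mem_FP (fanoutFn_mem_FP hp hq), fun w y => by
    rw [Function.comp_apply, fanoutFn_apply, gcdFn_boolPair, bitsToNat_encodeNat, hpv, hqv]⟩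

/-- Strict comparison of numeral expressions is a test (`ltFn`). -/
theorem pairTest_lt {φ ψ : List Bool → List Bool → ℕ}
    (hφ : ∃ f ∈ FP, ∀ w y : List Bool, bitsToNat (f (boolPair w y)) = φ w y)
    (hψ : ∃ f ∈ FP, ∀ w y : List Bool, bitsToNat (f (boolPair w y)) = ψ w y) :
    ∃ f ∈ FP, OneBit f ∧ ∀ w y : List Bool, f (boolPair w y) = [true] ↔ φ w y < ψ w y := by
  obtain ⟨p, hp, hpv⟩ := hφ
  obtain ⟨q, hq, hqv⟩ := hψ
  refine ⟨ltFn ∘ fanoutFn p q, comp_mem_FP ltFn_mem_FP (fanoutFn_mem_FP hp hq), oneBit_ltFn.comp _,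
    fun w y => ?_⟩
  rw [Function.comp_apply, fanoutFn_apply, ltFn_boolPair, hpv, hqv, List.cons.injEq, decide_eq_true_iff]
  exact and_iff_left rfl

/-- Equality of numeral expressions is a test (`eqValFn`). -/
theorem pairTest_eq {φ ψ : List Bool → List Bool → ℕ}
    (hφ : ∃ f ∈ FP, ∀ w y : List Bool, bitsToNat (f (boolPair w y)) = φ w y)
    (hψ : ∃ f ∈ FP, ∀ w y : List Bool, bitsToNat (f (boolPair w y)) = ψ w y) :
    ∃ f ∈ FP, OneBit f ∧ ∀ w y : List Bool, f (boolPair w y) = [true] ↔ φ w y = ψ w y := by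
  obtain ⟨p, hp, hpv⟩ := hφ
  obtain ⟨q, hq, hqv⟩ := hψ
  refine ⟨eqValFn ∘ fanoutFn p q, comp_mem_FP eqValFn_mem_FP (fanoutFn_mem_FP hp hq),
    oneBit_eqValFn.comp _, fun w y => ?_⟩
  rw [Function.comp_apply, fanoutFn_apply, eqValFn_boolPair, hpv, hqv, List.cons.injEq,
    decide_eq_true_iff]
  exact and_iff_left rfl

/-- Conjunction of tests (`andFn`). -/
theorem pairTest_and {P Q : List Bool → List Bool → Prop}
    (hP : ∃ f ∈ FP, OneBit f ∧ ∀ w y : List Bool, f (boolPair w y) = [true] ↔ P w y)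
    (hQ : ∃ f ∈ FP, OneBit f ∧ ∀ w y : List Bool, f (boolPair w y) = [true] ↔ Q w y) :
    ∃ f ∈ FP, OneBit f ∧ ∀ w y : List Bool, f (boolPair w y) = [true] ↔ (P w y ∧ Q w y) := by
  obtain ⟨p, hp, h1p, hpv⟩ := hP
  obtain ⟨q, hq, h1q, hqv⟩ := hQ
  refine ⟨andFn p q, andFn_mem_FP hp hq, oneBit_andFn h1p h1q, fun w y => ?_⟩
  obtain ⟨b, hb⟩ := h1p (boolPair w y)
  obtain ⟨b', hb'⟩ := h1q (boolPair w y)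
  rw [andFn_apply hb hb', ← hpv, ← hqv, hb, hb']
  cases b <;> cases b' <;> simp

/-- Disjunction of tests (`orFn`). -/
theorem pairTest_or {P Q : List Bool → List Bool → Prop}
    (hP : ∃ f ∈ FP, OneBit f ∧ ∀ w y : List Bool, f (boolPair w y) = [true] ↔ P w y)
    (hQ : ∃ f ∈ FP, OneBit f ∧ ∀ w y : List Bool, f (boolPair w y) = [true] ↔ Q w y) :
    ∃ f ∈ FP, OneBit f ∧ ∀ w y : List Bool, f (boolPair w y) = [true] ↔ (P w y ∨ Q w y) := by
  obtain ⟨p, hp, h1p, hpv⟩ := hP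
  obtain ⟨q, hq, h1q, hqv⟩ := hQ
  refine ⟨orFn p q, orFn_mem_FP hp hq, oneBit_orFn h1p h1q, fun w y => ?_⟩
  obtain ⟨b, hb⟩ := h1p (boolPair w y)
  obtain ⟨b', hb'⟩ := h1q (boolPair w y)
  rw [orFn_apply hb hb', ← hpv, ← hqv, hb, hb']
  cases b <;> cases b' <;> simp

/-- Negation of a test (`notFn`). -/
theorem pairTest_not {P : List Bool → List Bool → Prop}
    (hP : ∃ f ∈ FP, OneBit f ∧ ∀ w y : List Bool, f (boolPair w y) = [true] ↔ P w y) :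
    ∃ f ∈ FP, OneBit f ∧ ∀ w y : List Bool, f (boolPair w y) = [true] ↔ ¬ P w y := by
  obtain ⟨p, hp, h1p, hpv⟩ := hP
  refine ⟨notFn p, notFn_mem_FP hp, oneBit_notFn h1p, fun w y => ?_⟩
  obtain ⟨b, hb⟩ := h1p (boolPair w y)
  rw [notFn_apply hb, ← hpv, hb]
  cases b <;> simp

/-- Non-strict comparison `φ ≤ ψ` is a test (`¬ ψ < φ`). -/
theorem pairTest_le {φ ψ : List Bool → List Bool → ℕ}
    (hφ : ∃ f ∈ FP, ∀ w y : List Bool, bitsToNat (f (boolPair w y)) = φ w y)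
    (hψ : ∃ f ∈ FP, ∀ w y : List Bool, bitsToNat (f (boolPair w y)) = ψ w y) :
    ∃ f ∈ FP, OneBit f ∧ ∀ w y : List Bool, f (boolPair w y) = [true] ↔ φ w y ≤ ψ w y := by
  obtain ⟨f, hf, h1, hv⟩ := pairTest_not (pairTest_lt hψ hφ)
  exact ⟨f, hf, h1, fun w y => (hv w y).trans not_lt⟩

/-- Implication of tests. -/
theorem pairTest_imp {P Q : List Bool → List Bool → Prop}
    (hP : ∃ f ∈ FP, OneBit f ∧ ∀ w y : List Bool, f (boolPair w y) = [true] ↔ P w y)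
    (hQ : ∃ f ∈ FP, OneBit f ∧ ∀ w y : List Bool, f (boolPair w y) = [true] ↔ Q w y) :
    ∃ f ∈ FP, OneBit f ∧ ∀ w y : List Bool, f (boolPair w y) = [true] ↔ (P w y → Q w y) := by
  obtain ⟨f, hf, h1, hv⟩ := pairTest_or (pairTest_not hP) hQ
  exact ⟨f, hf, h1, fun w y => (hv w y).trans imp_iff_not_or.symm⟩

/-! ### The three blocks of a witness -/

/-- The first block `y ↾ (|w|+1)` is an `FP` function of `⟨w, y⟩` (`takeFn` against the unary
`1^{|w|+1}`), hence its value `a` is a numeral expression. -/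
theorem pairNat_blockA : ∃ f ∈ FP, ∀ w y : List Bool,
    bitsToNat (f (boolPair w y)) = bitsToNat (y.take (w.length + 1)) := by
  refine ⟨Plumb.takeFn ∘ fanoutFn (Plumb.polyFn (X + 1) ∘ fstF) sndF,
    comp_mem_FP Plumb.takeFn_mem_FP (fanoutFn_mem_FP
      (comp_mem_FP (Plumb.polyFn_mem_FP _) fstF_mem_FP) sndF_mem_FP), fun w y => ?_⟩
  rw [Function.comp_apply, fanoutFn_apply, Function.comp_apply, fstF_boolPair, sndF_boolPair,
    Plumb.polyFn_apply, Plumb.takeFn_boolPair]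
  simp [ones]

/-- The tail `y ⇂ (|w|+1)` is an `FP` function of `⟨w, y⟩`. -/
theorem exists_pairRestFn : ∃ f ∈ FP, ∀ w y : List Bool, f (boolPair w y) = y.drop (w.length + 1) := by
  refine ⟨Plumb.dropFn ∘ fanoutFn (Plumb.polyFn (X + 1) ∘ fstF) sndF,
    comp_mem_FP Plumb.dropFn_mem_FP (fanoutFn_mem_FP
      (comp_mem_FP (Plumb.polyFn_mem_FP _) fstF_mem_FP) sndF_mem_FP), fun w y => ?_⟩
  rw [Function.comp_apply, fanoutFn_apply, Function.comp_apply, fstF_boolPair, sndF_boolPair,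
    Plumb.polyFn_apply, Plumb.dropFn_boolPair]
  simp [ones]

/-- The second block `(y ⇂ (|w|+1)) ↾ (|w|+1)`: its value `t` is a numeral expression. -/
theorem pairNat_blockT : ∃ f ∈ FP, ∀ w y : List Bool,
    bitsToNat (f (boolPair w y)) = bitsToNat ((y.drop (w.length + 1)).take (w.length + 1)) := by
  obtain ⟨r, hr, hrv⟩ := exists_pairRestFn
  refine ⟨Plumb.takeFn ∘ fanoutFn (Plumb.polyFn (X + 1) ∘ fstF) r,
    comp_mem_FP Plumb.takeFn_mem_FP (fanoutFn_mem_FP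
      (comp_mem_FP (Plumb.polyFn_mem_FP _) fstF_mem_FP) hr), fun w y => ?_⟩
  rw [Function.comp_apply, fanoutFn_apply, Function.comp_apply, fstF_boolPair, hrv,
    Plumb.polyFn_apply, Plumb.takeFn_boolPair]
  simp [ones]

/-- The third block `(y ⇂ (|w|+1)) ⇂ (|w|+1)`: its value `c` is a numeral expression. -/
theorem pairNat_blockC : ∃ f ∈ FP, ∀ w y : List Bool,
    bitsToNat (f (boolPair w y)) = bitsToNat ((y.drop (w.length + 1)).drop (w.length + 1)) := by
  obtain ⟨r, hr, hrv⟩ := exists_pairRestFn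
  refine ⟨Plumb.dropFn ∘ fanoutFn (Plumb.polyFn (X + 1) ∘ fstF) r,
    comp_mem_FP Plumb.dropFn_mem_FP (fanoutFn_mem_FP
      (comp_mem_FP (Plumb.polyFn_mem_FP _) fstF_mem_FP) hr), fun w y => ?_⟩
  rw [Function.comp_apply, fanoutFn_apply, Function.comp_apply, fstF_boolPair, hrv,
    Plumb.polyFn_apply, Plumb.dropFn_boolPair]
  simp [ones]

end Summit.QuantumAdvantage.QuantumAdvantage.Theorems.IqThreeNotPPoly

end
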